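import Mathlib.MeasureTheory.Function.LpSeminorm.CompareExp
import Mathlib.MeasureTheory.Integral.Bochner.Basic
import Mathlib.MeasureTheory.Function.L1Space.Integrable
import HarnessLib

/-!
# C177 `Wu2026` — Prop 3.3 toolkit (part 1): Hölder pairings along `L^p`-convergent sequences

D-0090 NS-CLAIMS sweep, claim C177 (W. Wu, arXiv:2608.22471v1), skeleton
`Literature/Claims/NS/Wu2026.lean`; kernel objects for the binder `hP33` of `claim_of_steps''` —
Proposition 3.3 p.20 l.23–32 «For every β ∈ C¹(R) with ‖β′‖_∞ < ∞, the Euler tangent satisfies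
div(β(Q)V) = 0 in D′({|y| > 1}). (3.60)», typed as `Step_P33`. The printed proof is Sobolev
calculus (product and chain rules for `W^{1,p}_loc` functions with the exponent pairings
`2/9 + 5/9 = 7/9`, `7/9 + 2/9 = 1`); its kernel version passes to the limit along mollified
sequences in pairings `∫ c · aₙ · w`. This file records the generic measure-theoretic step:

* `tendsto_integral_of_norm_sub_le_mul` — if `‖Pₙ − P‖ ≤ C ‖aₙ − a‖ ‖w‖` pointwise,
  `‖aₙ − a‖_{L^p(μ)} → 0` and `w ∈ L^q(μ)` with `1/p + 1/q = 1`, then `∫ Pₙ dμ → ∫ P dμ`;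
* `tendsto_eLpNorm_of_tendsto_eLpNorm_of_le` — on a finite measure, `L^q`-convergence to `0`
  implies `L^p`-convergence to `0` for `p ≤ q`;
* the Hölder triples `(9/2, 9/7, 1)`, `(3/2, 3, 1)`, `(9/2, 9/5, 9/7)` in `ℝ≥0∞`.

Seat ns-in-wu-p33 (cell pub/ns-inputs, D-0154 (2) INPUTS). WHAT THIS IS NOT: not a claim about
NS regularity or blow-up; no summit statement is proved here.
-/

noncomputable section

set_option linter.dupNamespace false

open MeasureTheory Set Function Filter Topology
open scoped ENNReal NNReal Topology

namespace Summit.NavierStokesRegularity.NavierStokesRegularity.Theorems.Wu2026Salvage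

/-! ### Hölder triples used by the exponent bookkeeping of Prop 3.3 -/

/-- `(9/2)⁻¹ + (9/7)⁻¹ = 1`: the pairing `V ∈ L^{9/2}`, `∇Q ∈ L^{9/7}` (p.20 l.70–80
«7/9 + 2/9 = 1»). [cite: Wu2026, Prop 3.3 proof p.20 l.70–80] -/
theorem holderTriple_nineHalves_nineSevenths : ENNReal.HolderTriple ((9 : ℝ≥0∞) / 2) (9 / 7) 1 := by
  refine ⟨?_⟩
  rw [ENNReal.inv_div (Or.inr (by norm_num)) (Or.inr (by norm_num)),
    ENNReal.inv_div (Or.inr (by norm_num)) (Or.inr (by norm_num)), inv_one,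
    ENNReal.div_add_div_same, show (2 : ℝ≥0∞) + 7 = 9 by norm_num]
  exact ENNReal.div_self (by norm_num) (by norm_num)

/-- `(3/2)⁻¹ + 3⁻¹ = 1`: the pairing `Q ∈ L^{3/2}`, `V ∈ L³`. [folklore] -/
theorem holderTriple_threeHalves_three' : ENNReal.HolderTriple ((3 : ℝ≥0∞) / 2) 3 1 := by
  refine ⟨?_⟩
  rw [ENNReal.inv_div (Or.inr (by norm_num)) (Or.inr (by norm_num)), inv_one,
    show (3 : ℝ≥0∞)⁻¹ = 1 / 3 by rw [one_div], ENNReal.div_add_div_same,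
    show (2 : ℝ≥0∞) + 1 = 3 by norm_num]
  exact ENNReal.div_self (by norm_num) (by norm_num)

/-- `(9/2)⁻¹ + (9/5)⁻¹ = (9/7)⁻¹`: the product `V · ∇V ∈ L^{9/7}` for `V ∈ L^{9/2}`,
`∇V ∈ L^{9/5}` (p.20 l.45–50 «2/9 + 5/9 = 7/9»). [cite: Wu2026, Prop 3.3 proof p.20 l.45–50] -/
theorem holderTriple_nineHalves_nineFifths :
    ENNReal.HolderTriple ((9 : ℝ≥0∞) / 2) (9 / 5) (9 / 7) := by
  refine ⟨?_⟩
  rw [ENNReal.inv_div (Or.inr (by norm_num)) (Or.inr (by norm_num)),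
    ENNReal.inv_div (Or.inr (by norm_num)) (Or.inr (by norm_num)),
    ENNReal.inv_div (Or.inr (by norm_num)) (Or.inr (by norm_num)),
    ENNReal.div_add_div_same, show (2 : ℝ≥0∞) + 5 = 7 by norm_num]

/-! ### `L^q → L^p` on finite measures, along sequences -/

section FiniteMeasure

variable {X : Type*} [MeasurableSpace X] {μ : Measure X}
variable {G : Type*} [NormedAddCommGroup G]

/-- On a finite measure space, `‖fₙ‖_{L^q} → 0` implies `‖fₙ‖_{L^p} → 0` for `p ≤ q`
(`‖f‖_p ≤ ‖f‖_q μ(X)^{1/p − 1/q}`). [folklore] -/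
theorem tendsto_eLpNorm_of_tendsto_eLpNorm_of_le [IsFiniteMeasure μ] {p q : ℝ≥0∞} (hpq : p ≤ q)
    {f : ℕ → X → G} (hf : ∀ n, AEStronglyMeasurable (f n) μ)
    (h : Tendsto (fun n => eLpNorm (f n) q μ) atTop (𝓝 0)) :
    Tendsto (fun n => eLpNorm (f n) p μ) atTop (𝓝 0) := by
  rcases eq_or_ne p 0 with rfl | hp0
  · simp
  have hle : ∀ n, eLpNorm (f n) p μ ≤
      eLpNorm (f n) q μ * μ Set.univ ^ (1 / p.toReal - 1 / q.toReal) := fun n =>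
    eLpNorm_le_eLpNorm_mul_rpow_measure_univ hpq (hf n)
  have hfin : μ Set.univ ^ (1 / p.toReal - 1 / q.toReal) ≠ ∞ := by
    refine ENNReal.rpow_ne_top_of_nonneg ?_ (measure_ne_top μ _)
    rcases eq_or_ne q ∞ with rfl | hqT
    · simp only [ENNReal.toReal_top, div_zero, sub_zero]; positivity
    · rw [sub_nonneg]
      have hpT : p ≠ ∞ := ne_top_of_le_ne_top hqT hpq
      exact one_div_le_one_div_of_le (ENNReal.toReal_pos hp0 hpT)
        ((ENNReal.toReal_le_toReal hpT hqT).2 hpq)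
  refine tendsto_of_tendsto_of_tendsto_of_le_of_le tendsto_const_nhds ?_ (fun n => bot_le) hle
  have := ENNReal.Tendsto.mul_const h (Or.inr hfin)
  rwa [zero_mul] at this

end FiniteMeasure

/-! ### Pairings along `L^p`-convergent sequences -/

section Pairing

variable {X : Type*} [MeasurableSpace X] {μ : Measure X}
variable {F₁ : Type*} [NormedAddCommGroup F₁] {F₂ : Type*} [NormedAddCommGroup F₂]
variable {G : Type*} [NormedAddCommGroup G] [NormedSpace ℝ G]

/-- Hölder in the form `∫⁻ ‖a‖ₑ ‖w‖ₑ ≤ ‖a‖_{L^p} ‖w‖_{L^q}` for `1/p + 1/q = 1`. [folklore] -/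
theorem lintegral_enorm_mul_enorm_le {p q : ℝ≥0∞} [ENNReal.HolderTriple p q 1] {a : X → F₁}
    {w : X → F₂} (ha : AEStronglyMeasurable a μ) (hw : AEStronglyMeasurable w μ) :
    ∫⁻ x, ‖a x‖ₑ * ‖w x‖ₑ ∂μ ≤ eLpNorm a p μ * eLpNorm w q μ := by
  have h := eLpNorm_le_eLpNorm_mul_eLpNorm_of_nnnorm (μ := μ) ha hw
    (fun (u : F₁) (v : F₂) => (‖u‖ * ‖v‖ : ℝ)) 1
    (Eventually.of_forall fun x => by
      simp only [one_mul, nnnorm_mul, nnnorm_norm, le_refl]) (p := p) (q := q) (r := 1)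
  rw [ENNReal.coe_one, one_mul, eLpNorm_one_eq_lintegral_enorm] at h
  refine le_trans (le_of_eq (lintegral_congr fun x => ?_)) h
  rw [enorm_mul, enorm_norm, enorm_norm]

/-- **Pairings converge along `L^p`-convergent sequences.** If `‖Pₙ(x) − P(x)‖ ≤ C ‖aₙ(x) − a(x)‖
‖w(x)‖` for all `n`, `x`, with `‖aₙ − a‖_{L^p(μ)} → 0`, `w ∈ L^q(μ)`, `1/p + 1/q = 1`, and the
`Pₙ`, `P` are (a.e.-strongly) measurable with `P` integrable, then `∫ Pₙ dμ → ∫ P dμ`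
(Hölder and `tendsto_integral_of_L1`). This is the limit passage used for every term of the
mollified product / chain / transport identities of Prop 3.3. [cite: Wu2026, Prop 3.3 proof p.20 l.60–105] -/
theorem tendsto_integral_of_norm_sub_le_mul {p q : ℝ≥0∞} [ENNReal.HolderTriple p q 1]
    {P : ℕ → X → G} {P₀ : X → G} {a : ℕ → X → F₁} {a₀ : X → F₁} {w : X → F₂} {C : ℝ}
    (hPm : ∀ n, AEStronglyMeasurable (P n) μ) (hP₀ : Integrable P₀ μ)
    (ham : ∀ n, AEStronglyMeasurable (a n) μ) (ha₀m : AEStronglyMeasurable a₀ μ)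
    (hw : MemLp w q μ)
    (hbound : ∀ n x, ‖P n x - P₀ x‖ ≤ C * (‖a n x - a₀ x‖ * ‖w x‖))
    (hlim : Tendsto (fun n => eLpNorm (a n - a₀) p μ) atTop (𝓝 0)) :
    Tendsto (fun n => ∫ x, P n x ∂μ) atTop (𝓝 (∫ x, P₀ x ∂μ)) := by
  have hC : ∀ n x, ‖P n x - P₀ x‖ₑ ≤ ENNReal.ofReal C * (‖a n x - a₀ x‖ₑ * ‖w x‖ₑ) := by
    intro n x
    rw [← ofReal_norm, ← ofReal_norm, ← ofReal_norm, ← ENNReal.ofReal_mul (norm_nonneg _)]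
    rcases le_or_gt 0 C with hC0 | hC0
    · rw [← ENNReal.ofReal_mul hC0]
      exact ENNReal.ofReal_le_ofReal (hbound n x)
    · have h1 := hbound n x
      have h2 : C * (‖a n x - a₀ x‖ * ‖w x‖) ≤ 0 :=
        mul_nonpos_of_nonpos_of_nonneg hC0.le (by positivity)
      have h3 : ‖P n x - P₀ x‖ = 0 := le_antisymm (h1.trans h2) (norm_nonneg _)
      rw [h3, ENNReal.ofReal_zero]; exact zero_le
  -- the `L¹` distance is controlled by `C ‖aₙ − a‖_p ‖w‖_q`
  have hL1 : ∀ n, ∫⁻ x, ‖P n x - P₀ x‖ₑ ∂μ ≤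
      ENNReal.ofReal C * (eLpNorm (a n - a₀) p μ * eLpNorm w q μ) := fun n =>
    calc ∫⁻ x, ‖P n x - P₀ x‖ₑ ∂μ
        ≤ ∫⁻ x, ENNReal.ofReal C * (‖a n x - a₀ x‖ₑ * ‖w x‖ₑ) ∂μ := lintegral_mono (hC n)
      _ = ENNReal.ofReal C * ∫⁻ x, ‖a n x - a₀ x‖ₑ * ‖w x‖ₑ ∂μ := by
          have hm : AEMeasurable (fun x => ‖a n x - a₀ x‖ₑ * ‖w x‖ₑ) μ :=
            ((ham n).sub ha₀m).enorm.mul hw.1.enorm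
          rw [lintegral_const_mul'' _ hm]
      _ ≤ ENNReal.ofReal C * (eLpNorm (a n - a₀) p μ * eLpNorm w q μ) :=
          mul_le_mul' le_rfl (lintegral_enorm_mul_enorm_le ((ham n).sub ha₀m) hw.1)
  have hL1t : Tendsto (fun n => ∫⁻ x, ‖P n x - P₀ x‖ₑ ∂μ) atTop (𝓝 0) := by
    refine tendsto_of_tendsto_of_tendsto_of_le_of_le tendsto_const_nhds ?_ (fun n => bot_le) hL1
    have h1 := ENNReal.Tendsto.mul_const hlim (Or.inr hw.eLpNorm_ne_top)
    rw [zero_mul] at h1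
    have h2 := ENNReal.Tendsto.const_mul h1 (Or.inr ENNReal.ofReal_ne_top) (a := ENNReal.ofReal C)
    rwa [mul_zero] at h2
  -- eventually the `Pₙ` are integrable
  have hPi : ∀ᶠ n in atTop, Integrable (P n) μ := by
    have hev : ∀ᶠ n in atTop, ∫⁻ x, ‖P n x - P₀ x‖ₑ ∂μ < 1 :=
      hL1t (gt_mem_nhds (show (0 : ℝ≥0∞) < 1 from one_pos))
    filter_upwards [hev] with n hn
    have hd : Integrable (fun x => P n x - P₀ x) μ :=
      ⟨(hPm n).sub hP₀.1, lt_trans hn ENNReal.one_lt_top⟩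
    exact (hd.add hP₀).congr (Eventually.of_forall fun x => by simp)
  exact tendsto_integral_of_L1 P₀ hP₀.1 hPi hL1t

omit [NormedSpace ℝ G] in
/-- **Integrability of a pairing** dominated by `C ‖a‖ ‖w‖` with `a ∈ L^p`, `w ∈ L^q`,
`1/p + 1/q = 1`. [folklore] -/
theorem integrable_of_norm_le_mul {p q : ℝ≥0∞} [ENNReal.HolderTriple p q 1]
    {P : X → G} {a : X → F₁} {w : X → F₂} {C : ℝ}
    (hPm : AEStronglyMeasurable P μ) (ha : MemLp a p μ) (hw : MemLp w q μ)
    (hbound : ∀ x, ‖P x‖ ≤ C * (‖a x‖ * ‖w x‖)) : Integrable P μ := by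
  have h1 : MemLp (fun x => (‖a x‖ * ‖w x‖ : ℝ)) 1 μ := by
    have := MemLp.mul (f := fun x => ‖w x‖) (φ := fun x => ‖a x‖) hw.norm ha.norm (r := 1)
    simpa [Pi.mul_def] using this
  have h2 : Integrable (fun x => C * (‖a x‖ * ‖w x‖)) μ :=
    (memLp_one_iff_integrable.1 h1).const_mul C
  exact h2.mono' hPm (Eventually.of_forall hbound)

end Pairing

end Summit.NavierStokesRegularity.NavierStokesRegularity.Theorems.Wu2026Salvage
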